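import Summits.BirchSwinnertonDyer.BirchSwinnertonDyer.Theorems.SylvesterTwoHeegnerIndexUpperDescentNoNewRank
import HarnessLib

/-!
# Route `SylvesterTwoHeegnerIndex` (rung K7t), crux `HeegnerIndexUpperAtTwoHSY` (item 19229), layer 2:
# the clean descent at `2` in FRAME FORM — for a Sylvester curve `E_p` and a quadratic field `K′`
# whose twist `E_p^{(d_{K′})}` has rank `0`, `Ш(E_p/ℚ) → Ш(E_p/K′)` is injective

HONEST FRAMING (cell «bsd-cm», D-0074 seat `bsd-cm-k7t-c2`, item stmt-BirchSwinnertonDyer-19229; the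
crux — the Euler-system half of `BSD(E_p, 2)` on 𝒞_HSY — stays OPEN; nothing booked). Last link of the
seat's descent chain (p420915 → p421567 → p422249 → p423622 → p424734): the two inputs still displayed
in `shaRestriction_injective_sylvester_of_rank` — `[K̃′ : ℚ] = 2` for the Galois closure `K̃′ ⊆ ℚ̄` and
the rank identity over `K̃′` — are DISCHARGED from statements about `K′` itself:
* `finrank_galoisClosureIn_eq_of_normal` — for a NORMAL finite extension `L/K` of number fields the
  Galois closure `L̃ ⊆ K̄` is the image of any embedding, so `[L̃ : K] = [L : K]`;
* `mordellWeilRank_baseChange_galoisClosureIn_eq` — `rank E(L̃) = rank E(L)` (the embedding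
  `L ≃ L̃` transports points; ranks compared by injections both ways, Mordell–Weil for finiteness);
* **`shaRestriction_injective_sylvester_quadratic`** — for `W` an elliptic model of `E_p` (`p` odd
  prime) and `K′` a number field with `[K′ : ℚ] = 2`: `rank E_p(K′) = rank E_p(ℚ) ⇒ Ш(E_p/ℚ) ↪ Ш(E_p/K′)`;
* **`shaRestriction_injective_sylvester_of_twist_rank_zero`** — the same with the hypothesis in
  FRAME FORM: `rank E_p^{(d_{K′})}(ℚ) = 0` (tree identity `rank E(K′) = rank E(ℚ) + rank E^{(d_{K′})}(ℚ)`,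
  `mordellWeilRank_baseChange_of_finrank_eq_two_of_finite`). In a Heegner frame of the route this is
  `L(E_p^{(d_{K′})}, 1) ≠ 0` + Gross–Zagier–Kolyvagin / Burungale–Flach (named facts; not used here).
So on 𝒞_HSY the `K′ → ℚ` step of the Kolyvagin road costs NO power of `2` in any frame with rank-zero
twin; the crux's open content is the SHARP Kolyvagin index bound over `K′` at `p = 2`.
References: [SilvermanAEC2009] VIII.§1, Exercise 10.16, X.§4; [GrossLMS1991] §2; [Darmon2004] §3.9.
-/

set_option autoImplicit false
set_option linter.dupNamespace false

noncomputable section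

open scoped Classical Pointwise

universe u

open Literature.NumberTheory.EllipticCurves Literature.NumberTheory.EllipticCurves.HuShuYin2019
  WeierstrassCurve IntermediateField

namespace Summit.BirchSwinnertonDyer.BirchSwinnertonDyer.Theorems.SylvesterTwoUpper

/-! ## §1 The Galois closure of a normal extension has the same degree -/

section Generic

variable {K : Type u} [Field K] [NumberField K] (L : Type u) [Field L] [NumberField L] [Algebra K L]

/-- **`[L̃ : K] = [L : K]` for `L/K` normal**: the Galois closure `L̃ ⊆ K̄` (the normal closure of
`L/K` in `K̄`) is the field range `E` of any `K`-embedding `φ : L → K̄`, because `E ≅ L` is normal and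
every `K`-embedding of `L` lands in `E`; and `E ≅ L` as `K`-vector spaces. [folklore] -/
theorem finrank_galoisClosureIn_eq_of_normal [Normal K L] :
    Module.finrank K (galoisClosureIn (K := K) L) = Module.finrank K L := by
  haveI : FiniteDimensional K L := Module.Finite.of_restrictScalars_finite ℚ K L
  let φ : L →ₐ[K] AlgebraicClosure K := IsAlgClosed.lift
  let E : IntermediateField K (AlgebraicClosure K) := φ.fieldRange
  let e : L ≃ₐ[K] E := AlgEquiv.ofInjectiveField φ
  haveI : Normal K E := Normal.of_algEquiv e
  have key : galoisClosureIn (K := K) L = E := by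
    apply le_antisymm
    · rw [galoisClosureIn, normalClosure_le_iff]
      intro f
      -- `f = g ∘ e` with `g : E →ₐ[K] K̄`, and `g.fieldRange = E` by normality of `E`
      let g : E →ₐ[K] AlgebraicClosure K := f.comp (e.symm : E →ₐ[K] L)
      have hg : g.fieldRange = E := (IntermediateField.normal_iff_forall_fieldRange_eq.mp inferInstance) g
      have hfg : f.fieldRange = g.fieldRange := by
        apply SetLike.coe_injective
        simp only [AlgHom.coe_fieldRange]
        ext z
        constructor
        · rintro ⟨x, rfl⟩; exact ⟨e x, by simp [g]⟩
        · rintro ⟨y, rfl⟩; exact ⟨e.symm y, rfl⟩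
      rw [hfg, hg]
    · exact φ.fieldRange_le_normalClosure
  rw [key]
  exact e.toLinearEquiv.finrank_eq.symm

/-- **`rank E(L̃) = rank E(L)`**: transport of points along `L ≃ L̃` (both finitely generated, so
`finrank` over `ℤ` is compared by the two injections `Point.map`). [cite: SilvermanAEC2009, VIII.§1] -/
theorem mordellWeilRank_baseChange_galoisClosureIn_eq [Normal K L] (W : WeierstrassCurve K) [W.IsElliptic] :
    (W.baseChange (galoisClosureIn (K := K) L)).mordellWeilRank = (W.baseChange L).mordellWeilRank := by
  haveI : FiniteDimensional K L := Module.Finite.of_restrictScalars_finite ℚ K L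
  let φ : L →ₐ[K] AlgebraicClosure K := IsAlgClosed.lift
  let E : IntermediateField K (AlgebraicClosure K) := φ.fieldRange
  let e : L ≃ₐ[K] E := AlgEquiv.ofInjectiveField φ
  haveI : Normal K E := Normal.of_algEquiv e
  have key : galoisClosureIn (K := K) L = E := by
    apply le_antisymm
    · rw [galoisClosureIn, normalClosure_le_iff]
      intro f
      let g : E →ₐ[K] AlgebraicClosure K := f.comp (e.symm : E →ₐ[K] L)
      have hg : g.fieldRange = E := (IntermediateField.normal_iff_forall_fieldRange_eq.mp inferInstance) g
      have hfg : f.fieldRange = g.fieldRange := by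
        apply SetLike.coe_injective
        simp only [AlgHom.coe_fieldRange]
        ext z
        constructor
        · rintro ⟨x, rfl⟩; exact ⟨e x, by simp [g]⟩
        · rintro ⟨y, rfl⟩; exact ⟨e.symm y, rfl⟩
      rw [hfg, hg]
    · exact φ.fieldRange_le_normalClosure
  -- the embedding `L → L̃` and its inverse on points
  have hEL : E ≤ galoisClosureIn (K := K) L := key.ge
  have hLE : galoisClosureIn (K := K) L ≤ E := key.le
  let i₁ : L →ₐ[K] galoisClosureIn (K := K) L := (IntermediateField.inclusion hEL).comp (e : L →ₐ[K] E)
  let i₂ : galoisClosureIn (K := K) L →ₐ[K] L :=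
    (e.symm : E →ₐ[K] L).comp (IntermediateField.inclusion hLE)
  -- Mordell–Weil over both number fields
  haveI : (W.baseChange (galoisClosureIn (K := K) L)).IsElliptic := by
    rw [WeierstrassCurve.baseChange]; infer_instance
  haveI : (W.baseChange L).IsElliptic := by rw [WeierstrassCurve.baseChange]; infer_instance
  have hfg₁ := (W.baseChange (galoisClosureIn (K := K) L)).addGroup_fg_point_holds
  have hfg₂ := (W.baseChange L).addGroup_fg_point_holds
  haveI : AddGroup.FG (W.baseChange (galoisClosureIn (K := K) L)).toAffine.Point := by convert hfg₁
  haveI : AddGroup.FG (W.baseChange L).toAffine.Point := by convert hfg₂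
  haveI : Module.Finite ℤ (W.baseChange (galoisClosureIn (K := K) L)).toAffine.Point :=
    Module.Finite.iff_addGroup_fg.mpr inferInstance
  haveI : Module.Finite ℤ (W.baseChange L).toAffine.Point := Module.Finite.iff_addGroup_fg.mpr inferInstance
  -- injections both ways
  have h₁ : Module.finrank ℤ (W.baseChange L).toAffine.Point ≤
      Module.finrank ℤ (W.baseChange (galoisClosureIn (K := K) L)).toAffine.Point :=
    LinearMap.finrank_le_finrank_of_injective
      (f := (Affine.Point.map (W' := W) i₁).toIntLinearMap) (Affine.Point.map_injective (W' := W) _)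
  have h₂ : Module.finrank ℤ (W.baseChange (galoisClosureIn (K := K) L)).toAffine.Point ≤
      Module.finrank ℤ (W.baseChange L).toAffine.Point :=
    LinearMap.finrank_le_finrank_of_injective
      (f := (Affine.Point.map (W' := W) i₂).toIntLinearMap) (Affine.Point.map_injective (W' := W) _)
  have h := le_antisymm h₂ h₁
  -- `mordellWeilRank` is `finrank ℤ` (elaborated against the classical `DecidableEq`)
  convert h using 1 <;> (unfold WeierstrassCurve.mordellWeilRank; congr!)

end Generic

/-! ## §2 The descent for `E_p` along a quadratic field, frame form -/

/-- **`Ш(E_p/ℚ) → Ш(E_p/K′)` is INJECTIVE for `[K′ : ℚ] = 2` whenever `rank E_p(K′) = rank E_p(ℚ)`**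
(`p` an odd prime, `W` any elliptic model of `E_p` over `ℚ`). A quadratic extension is normal
(`Algebra.IsQuadraticExtension.normal`), so §1 turns the two displayed inputs of
`shaRestriction_injective_sylvester_of_rank` into statements over `K′`.
[cite: GrossLMS1991, §2] [cite: SilvermanAEC2009, X.§4] -/
theorem shaRestriction_injective_sylvester_quadratic {p : ℕ} (hp : p.Prime) (hp2 : p ≠ 2)
    (W : WeierstrassCurve ℚ) [W.IsElliptic]
    (hW : ∃ C : VariableChange ℚ, C • W = cubeSumCurve (p : ℚ))
    (K' : Type) [Field K'] [NumberField K'] (hK : Module.finrank ℚ K' = 2)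
    (hrank : (W.baseChange K').mordellWeilRank = W.mordellWeilRank) :
    Function.Injective (shaRestriction W K') := by
  haveI : Algebra.IsQuadraticExtension ℚ K' := { finrank_eq_two' := hK }
  have hL : Module.finrank ℚ (galoisClosureIn (K := ℚ) K') = 2 := by
    have h := finrank_galoisClosureIn_eq_of_normal (K := ℚ) K'
    rw [hK] at h
    convert h using 2
  have hrank' : (W.baseChange (galoisClosureIn (K := ℚ) K')).mordellWeilRank = W.mordellWeilRank := by
    have h1 := mordellWeilRank_baseChange_galoisClosureIn_eq (K := ℚ) K' W
    rw [hrank] at h1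
    -- (the `ℚ`-algebra structure on `K̃′` found here and the intermediate-field one of §1 agree:
    -- `Subsingleton (Algebra ℚ _)`, bridged by `convert`)
    convert h1 using 2
    unfold WeierstrassCurve.baseChange
    congr 1
  exact shaRestriction_injective_sylvester_of_rank hp hp2 W hW K' hL hrank'

/-- **Frame form: `rank E_p^{(d_{K′})}(ℚ) = 0 ⇒ Ш(E_p/ℚ) ↪ Ш(E_p/K′)`** (`[K′ : ℚ] = 2`, `p` an odd
prime, `W` any elliptic model of `E_p`). The tree's quadratic base-change identity
`rank E(K′) = rank E(ℚ) + rank E^{(d_{K′})}(ℚ)` (`mordellWeilRank_baseChange_of_finrank_eq_two_of_finite`,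
Mordell–Weil over `K′` for finiteness) turns «twin of rank `0`» into «no new rank over `K′`». In every
Heegner frame of the route the twin has rank `0` (`L(E_p^{(d_{K′})},1) ≠ 0` + GZK / Burungale–Flach,
named facts NOT used here), so the `K′ → ℚ` descent of the Kolyvagin road at `2` loses no power of
`2` on 𝒞_HSY. [cite: SilvermanAEC2009, Exercise 10.16 and X.§4] [cite: GrossLMS1991, §2] -/
theorem shaRestriction_injective_sylvester_of_twist_rank_zero {p : ℕ} (hp : p.Prime) (hp2 : p ≠ 2)
    (W : WeierstrassCurve ℚ) [W.IsElliptic]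
    (hW : ∃ C : VariableChange ℚ, C • W = cubeSumCurve (p : ℚ))
    (K' : Type) [Field K'] [NumberField K'] (hK : Module.finrank ℚ K' = 2)
    (htwist : (W.quadraticTwist (NumberField.discr K' : ℚ)).mordellWeilRank = 0) :
    Function.Injective (shaRestriction W K') := by
  -- Mordell–Weil over `K′`
  haveI : (W.baseChange K').IsElliptic := by rw [WeierstrassCurve.baseChange]; infer_instance
  have hfg := (W.baseChange K').addGroup_fg_point_holds
  haveI : AddGroup.FG (W.baseChange K').toAffine.Point := by convert hfg
  haveI : Module.Finite ℤ (W.baseChange K').toAffine.Point := Module.Finite.iff_addGroup_fg.mpr inferInstance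
  have hrank : (W.baseChange K').mordellWeilRank = W.mordellWeilRank := by
    have h := mordellWeilRank_baseChange_of_finrank_eq_two_of_finite W K' hK
    rw [htwist, add_zero] at h
    convert h using 1
  exact shaRestriction_injective_sylvester_quadratic hp hp2 W hW K' hK hrank

end Summit.BirchSwinnertonDyer.BirchSwinnertonDyer.Theorems.SylvesterTwoUpper

end
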